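import Summits.CriticalPhenomena.PercolationContinuityZ3.Theorems.PercAnnulusCrossingIICAtomsLowerTransfer
import HarnessLib

/-!
# The multipoint lower bound across separated scales in FINITE VOLUME: k far points cost `∏ (c·π)` given the arm (lane RSW3, p1 gen 19)

builds on p205010 (kernel theorem, internal audit signed; external expert review pending) — NOT used in this file.

RSW3 lane (LANE 3 `prim-rsw3`), seat `prim-rsw3-p1` (gen 19).  Helper file (`--supports stmt-CriticalPhenomena-4575`);
no definitions, no sorries; every `d`, every `p`.  Memo `run/shared/lean/prim/rsw3/P1-QM.md` §32 (LANE-4 observable O6).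

The finite-volume companions of gen 19 (6)–(7), for the arm-conditioned measures `P_p(· | 0 ↔ ∂ⁱⁿΛ(n))` that the census samples:

* **`mul_real_inter_inter_siteToBoundary_le_of_saturated`** — hypotheses of gen 18 (13) (`CU⁺_l(c_U)`, single-level UAD with `εB_l ≤ 1/2`, ratio
  bound, `u = sKb`, `z ∈ Λ(64u) ∖ Λ(32u)`, `n ≥ 64lu`): for every measurable `H` reading only the cluster of `0` inside `Λ(b)`:
  **`(c_U/2B_l)·π_p(64u)·P_p(H ∩ A_n) ≤ P_p(H ∩ {0 ↔ z in Λ(64lu)} ∩ A_n)`** — given the arm AND any cluster-saturated inside event, the far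
  point joins the cluster of the root with probability `≥ (c_U/2B_l)·π(64u)`;
* **`prod_mul_real_biInter_openConnIn_inter_siteToBoundary_le`** — along the geometric scales `b_{i+1} = 64 l sK b_i`, one site per shell, for
  every `k` and `n ≥ b_k`: **`∏_{i<k}((c_U/2B_l)·π_p(64u_i)) · π_p(n) ≤ P_p(⋂_{i<k} {0 ↔ z_i in Λ(b_k)} ∩ {0 ↔ ∂ⁱⁿΛ(n)})`** — in arm-conditioned
  samples, k marked far sites (one per shell) ALL lie in the cluster of the root with frequency at least the product of `(c_U/2B_l)·π(64u_i)`.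
References: H. Kesten, Probab. Theory Relat. Fields 73 (1986), §2 (2.16), Thm. (8).
-/

noncomputable section

namespace Summit.CriticalPhenomena.PercolationContinuityZ3.Theorems.Crossing

open MeasureTheory Filter Topology Literature.Probability.Percolation Literature.Probability.LatticeModels
open Literature.Probability.Percolation.DCT16
open Summit.CriticalPhenomena.PercolationContinuityZ3.Theorems.SurfaceTension

variable {d : ℕ}

/-- **THE SHARP QUENCHED TWO-POINT BOUND IN FINITE VOLUME, FOR EVERY CLUSTER-SATURATED INSIDE EVENT** (every `d`, `p`; hypotheses of gen 18 (13);
`u = sKb`, `z ∈ Λ(64u) ∖ Λ(32u)`, `64lu ≤ n`): for every measurable `H` that does not distinguish lattice configurations with the same cluster of `0`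
inside `Λ(b)` and the same states on the pairs at it (every `H`, measurable or not): **`(c_U/2B_l)·π_p(64u)·P_p(H ∩ A_n) ≤ P_p(H ∩ {0 ↔ z in Λ(64lu)} ∩ A_n)`**.
[cite: Kesten1986, §2 (2.16)] -/
theorem mul_real_inter_inter_siteToBoundary_le_of_saturated (p : unitInterval) {l : ℕ} (hl : 2 ≤ l) {cU : ℝ} (hcU : 0 ≤ cU)
    (hCU : ∀ a : ℕ, 1 ≤ a → ∀ E : Set (BondConfig (Site d)), IsUpperSet E → MeasurableSet E →
      cU * (bondPercolation (zdGraph d) p).real E ≤ (bondPercolation (zdGraph d) p).real (E ∩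
        {ω : BondConfig (Site d) | ∀ t ∈ innerBoundary (zdGraph d) (box d a), ∀ s ∈ innerBoundary (zdGraph d) (box d (l * a)),
          ∀ t' ∈ innerBoundary (zdGraph d) (box d a), ∀ s' ∈ innerBoundary (zdGraph d) (box d (l * a)),
          ω ∈ openConnIn (↑((box d (l * a) \ box d a) ∪ innerBoundary (zdGraph d) (box d a)) : Set (Site d)) t s →
          ω ∈ openConnIn (↑((box d (l * a) \ box d a) ∪ innerBoundary (zdGraph d) (box d a)) : Set (Site d)) t' s' →
          ω ∈ openConnIn (↑((box d (l * a) \ box d a) ∪ innerBoundary (zdGraph d) (box d a)) : Set (Site d)) s s'}))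
    {ε Bl : ℝ} (hBl : 0 < Bl) (hεB : ε * Bl ≤ 1 / 2) {K₀ : ℕ}
    (hUAD : ∀ m : ℕ, 1 ≤ m → ∀ N : ℕ, K₀ * m ≤ N → (bondPercolation (zdGraph d) p).real (boxCrossing d m N) ≤ ε)
    (hRl : ∀ j m : ℕ, 1 ≤ j → j ≤ m → m ≤ 4 * (l + 1) * j → oneArmProb d p j ≤ Bl * oneArmProb d p m)
    {s K b n : ℕ} (hs : 2 ≤ s) (hK : 1 ≤ K) (hK₀ : K₀ ≤ 16 * s * K) (hb : 1 ≤ b) (hn : l * (64 * (s * K * b)) ≤ n)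
    {H : Set (BondConfig (Site d))}
    (hH : ∀ ω ω' : BondConfig (Site d), ω ⊆ (zdGraph d).edgeSet → ω' ⊆ (zdGraph d).edgeSet →
      (∀ z, ω ∈ openConnIn (↑(box d b) : Set (Site d)) 0 z ↔ ω' ∈ openConnIn (↑(box d b) : Set (Site d)) 0 z) →
      (∀ x z, ω ∈ openConnIn (↑(box d b) : Set (Site d)) 0 x → z ∈ box d (b + 1) → (s(x, z) ∈ ω ↔ s(x, z) ∈ ω')) →
      ω ∈ H → ω' ∈ H)
    {z : Site d} (hz : z ∈ box d (64 * (s * K * b)) \ box d (32 * (s * K * b))) :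
    cU / (2 * Bl) * oneArmProb d p (64 * (s * K * b)) * (bondPercolation (zdGraph d) p).real (H ∩ siteToBoundary d n) ≤
      (bondPercolation (zdGraph d) p).real (H ∩ openConnIn (↑(box d (l * (64 * (s * K * b)))) : Set (Site d)) 0 z ∩ siteToBoundary d n) := by
  classical
  set F : Finset (Site d) → Finset (Sym2 (Site d)) := fun V => (V ×ˢ (box d b \ V)).image fun q => s(q.1, q.2) with hFdef
  set Kf : Finset (Site d) → Finset (Sym2 (Site d)) := fun V => (V ×ˢ box d (b + 1)).image fun q => s(q.1, q.2) with hKdef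
  set Y : Finset (Site d) → Finset (Sym2 (Site d)) → Finset (Site d) := fun V η =>
    (box d (b + 1) \ box d b).filter fun y => ∃ x ∈ V, s(x, y) ∈ η ∧ (zdGraph d).Adj x y with hYdef
  have hF : ∀ V e, e ∈ F V ↔ ∃ x ∈ V, ∃ y ∈ box d b, y ∉ V ∧ e = s(x, y) := by
    intro V e
    simp only [hFdef, Finset.mem_image, Finset.mem_product, Finset.mem_sdiff, Prod.exists]
    constructor
    · rintro ⟨x, y, ⟨hx, hy, hyV⟩, rfl⟩; exact ⟨x, hx, y, hy, hyV, rfl⟩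
    · rintro ⟨x, hx, y, hy, hyV, rfl⟩; exact ⟨x, y, ⟨hx, hy, hyV⟩, rfl⟩
  have hKf : ∀ V e, e ∈ Kf V ↔ ∃ x ∈ V, ∃ y ∈ box d (b + 1), e = s(x, y) := by
    intro V e
    simp only [hKdef, Finset.mem_image, Finset.mem_product, Prod.exists]
    constructor
    · rintro ⟨x, y, ⟨hx, hy⟩, rfl⟩; exact ⟨x, hx, y, hy, rfl⟩
    · rintro ⟨x, hx, y, hy, rfl⟩; exact ⟨x, y, ⟨hx, hy⟩, rfl⟩
  have hY : ∀ V η y, y ∈ Y V η ↔ y ∈ box d (b + 1) ∧ y ∉ box d b ∧ ∃ x ∈ V, s(x, y) ∈ η ∧ (zdGraph d).Adj x y := by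
    intro V η y
    rw [hYdef, Finset.mem_filter, Finset.mem_sdiff, and_assoc]
  have hsat := atomSaturated_of_saturated (m := b) F Kf hF hKf hH
  have hTm : MeasurableSet (openConnIn (↑(box d (l * (64 * (s * K * b)))) : Set (Site d)) (0 : Site d) z) := measurableSet_openConnIn _ 0 z
  have hθ : 0 ≤ cU / (2 * Bl) * oneArmProb d p (64 * (s * K * b)) :=
    mul_nonneg (div_nonneg hcU (by positivity)) (by unfold oneArmProb; exact measureReal_nonneg)
  exact real_inter_inter_siteToBoundary_ge_of_atoms p F Kf hF hKf hTm hsat hθ fun V hVb h0 η _ =>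
    mul_real_atom_inter_siteToBoundary_le p hl hcU hCU hBl hεB hUAD hRl hs hK hK₀ hb hn hVb h0 (hF V) (hKf V) (hY V η) hz

/-- **k FAR POINTS, GIVEN THE ARM, IN FINITE VOLUME** (every `d`, `p`; hypotheses of gen 18 (13); scales `b_0 ≥ 1`, `b_{i+1} = l·64·sK·b_i`; sites
`z_i ∈ Λ(64 sK b_i) ∖ Λ(32 sK b_i)`): for every `k` and every `n ≥ b_k`,
**`(∏_{i<k} (c_U/2B_l)·π_p(64 sK b_i)) · π_p(n) ≤ P_p(⋂_{i<k} {0 ↔ z_i in Λ(b_k)} ∩ {0 ↔ ∂ⁱⁿΛ(n)})`** — a LANE-4 observable: in arm-conditioned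
samples the k marked far sites all lie in the cluster of the root with frequency `≥ ∏ (c_U/2B_l)π(64u_i)`. [cite: Kesten1986, Thm. (8)] -/
theorem prod_mul_real_biInter_openConnIn_inter_siteToBoundary_le (p : unitInterval) {l : ℕ} (hl : 2 ≤ l) {cU : ℝ} (hcU : 0 ≤ cU)
    (hCU : ∀ a : ℕ, 1 ≤ a → ∀ E : Set (BondConfig (Site d)), IsUpperSet E → MeasurableSet E →
      cU * (bondPercolation (zdGraph d) p).real E ≤ (bondPercolation (zdGraph d) p).real (E ∩
        {ω : BondConfig (Site d) | ∀ t ∈ innerBoundary (zdGraph d) (box d a), ∀ s ∈ innerBoundary (zdGraph d) (box d (l * a)),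
          ∀ t' ∈ innerBoundary (zdGraph d) (box d a), ∀ s' ∈ innerBoundary (zdGraph d) (box d (l * a)),
          ω ∈ openConnIn (↑((box d (l * a) \ box d a) ∪ innerBoundary (zdGraph d) (box d a)) : Set (Site d)) t s →
          ω ∈ openConnIn (↑((box d (l * a) \ box d a) ∪ innerBoundary (zdGraph d) (box d a)) : Set (Site d)) t' s' →
          ω ∈ openConnIn (↑((box d (l * a) \ box d a) ∪ innerBoundary (zdGraph d) (box d a)) : Set (Site d)) s s'}))
    {ε Bl : ℝ} (hBl : 0 < Bl) (hεB : ε * Bl ≤ 1 / 2) {K₀ : ℕ}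
    (hUAD : ∀ m : ℕ, 1 ≤ m → ∀ N : ℕ, K₀ * m ≤ N → (bondPercolation (zdGraph d) p).real (boxCrossing d m N) ≤ ε)
    (hRl : ∀ j m : ℕ, 1 ≤ j → j ≤ m → m ≤ 4 * (l + 1) * j → oneArmProb d p j ≤ Bl * oneArmProb d p m)
    {s K : ℕ} (hs : 2 ≤ s) (hK : 1 ≤ K) (hK₀ : K₀ ≤ 16 * s * K)
    (b : ℕ → ℕ) (hb0 : 1 ≤ b 0) (hb : ∀ i, b (i + 1) = l * (64 * (s * K * b i)))
    (z : ℕ → Site d) (hz : ∀ i, z i ∈ box d (64 * (s * K * b i)) \ box d (32 * (s * K * b i))) :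
    ∀ (k n : ℕ), b k ≤ n →
      (∏ i ∈ Finset.range k, cU / (2 * Bl) * oneArmProb d p (64 * (s * K * b i))) * oneArmProb d p n ≤
        (bondPercolation (zdGraph d) p).real ((⋂ i ∈ Finset.range k, openConnIn (↑(box d (b k)) : Set (Site d)) 0 (z i)) ∩ siteToBoundary d n) := by
  set μ := bondPercolation (zdGraph d) p with hμ
  have hb1 : ∀ i, 1 ≤ b i := by
    intro i
    induction i with
    | zero => exact hb0
    | succ i ih =>
      rw [hb i]
      have : 1 ≤ s * K * b i := Nat.one_le_iff_ne_zero.2 (by positivity)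
      nlinarith
  have hbmono : ∀ i, b i ≤ b (i + 1) := by
    intro i
    rw [hb i]
    have h1 : b i ≤ s * K * b i := Nat.le_mul_of_pos_left _ (by positivity)
    have h3 : 64 * (s * K * b i) ≤ l * (64 * (s * K * b i)) := Nat.le_mul_of_pos_left _ (by omega)
    omega
  intro k
  induction k with
  | zero =>
    intro n _
    simp only [Finset.range_zero, Finset.prod_empty, one_mul, Finset.notMem_empty, Set.iInter_of_empty, Set.iInter_univ, Set.univ_inter]
    exact le_of_eq rfl
  | succ k ih =>
    intro n hn
    have hkn : b k ≤ n := (hbmono k).trans hn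
    have hn' : l * (64 * (s * K * b k)) ≤ n := by rw [← hb k]; exact hn
    set H : Set (BondConfig (Site d)) := ⋂ i ∈ Finset.range k, openConnIn (↑(box d (b k)) : Set (Site d)) 0 (z i) with hH
    have hstep := mul_real_inter_inter_siteToBoundary_le_of_saturated p hl hcU hCU hBl hεB hUAD hRl hs hK hK₀ (hb1 k) hn'
      (biInter_openConnIn_saturated (b k) (Finset.range k) z) (hz k)
    have hθ : 0 ≤ cU / (2 * Bl) * oneArmProb d p (64 * (s * K * b k)) :=
      mul_nonneg (div_nonneg hcU (by positivity)) (by unfold oneArmProb; exact measureReal_nonneg)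
    have hsub : H ∩ openConnIn (↑(box d (l * (64 * (s * K * b k)))) : Set (Site d)) 0 (z k) ∩ siteToBoundary d n ⊆
        (⋂ i ∈ Finset.range (k + 1), openConnIn (↑(box d (b (k + 1))) : Set (Site d)) 0 (z i)) ∩ siteToBoundary d n := by
      rintro ω ⟨⟨hωH, hωk⟩, hωA⟩
      refine ⟨?_, hωA⟩
      rw [Finset.range_add_one, Finset.set_biInter_insert]
      refine ⟨by rw [hb k]; exact hωk, ?_⟩
      rw [hH] at hωH
      exact Set.biInter_mono (fun i hi => hi)
        (fun i _ => openConnIn_mono (Finset.coe_subset.2 (box_mono d (hbmono k))) (0 : Site d) (z i)) hωH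
    rw [Finset.prod_range_succ]
    calc (∏ i ∈ Finset.range k, cU / (2 * Bl) * oneArmProb d p (64 * (s * K * b i))) *
          (cU / (2 * Bl) * oneArmProb d p (64 * (s * K * b k))) * oneArmProb d p n
        = cU / (2 * Bl) * oneArmProb d p (64 * (s * K * b k)) *
            ((∏ i ∈ Finset.range k, cU / (2 * Bl) * oneArmProb d p (64 * (s * K * b i))) * oneArmProb d p n) := by ring
      _ ≤ cU / (2 * Bl) * oneArmProb d p (64 * (s * K * b k)) * μ.real (H ∩ siteToBoundary d n) :=
          mul_le_mul_of_nonneg_left (ih n hkn) hθ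
      _ ≤ μ.real (H ∩ openConnIn (↑(box d (l * (64 * (s * K * b k)))) : Set (Site d)) 0 (z k) ∩ siteToBoundary d n) := hstep
      _ ≤ μ.real ((⋂ i ∈ Finset.range (k + 1), openConnIn (↑(box d (b (k + 1))) : Set (Site d)) 0 (z i)) ∩ siteToBoundary d n) :=
          measureReal_mono hsub

end Summit.CriticalPhenomena.PercolationContinuityZ3.Theorems.Crossing

end
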